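import Summits.QuantumFields.BalabanUV.Beta.FP.PackedLawFullIndexGraded
import Summits.QuantumFields.BalabanUV.Beta.CombHId2TorusTwin

/-!
# `BalabanUV.Beta.FP.PackedLawFullIndexGradedSocket` — road «FP» for binder row D1, ROUTE T, RULING R-FP-80 (J-RISK-2′): **THE ASSEMBLY SOCKET (S3-3) WITH THE
# SECOND-ORDER SLOT PARITY-BLIND** — #26 `PackedLawFullIndex.hessT_fullIndex_law_of_packed_law` with, for each of the three systems `X ∈ {N, F, G}`, the border-parity
# letter `hW_Xt` REPLACED by the chart parity `hAσ_X` («`perF M_X A_X` is graded-even») and the second-order (S3-2) bindings against the DISPLAYED even blocks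
# `hH_X₂ : H_X₂ = Matrix.of (b b′ ↦ ½(Ŵ_X b̃ b̃′ + Ŵ_X b̃′ b̃))`, `hQ_X₂ : Q_X₂ = Matrix.of (a b ↦ ½(Ŵ_X (f_X a) b̃ − Ŵ_X b̃ (f_X a)))`; conclusion UNCHANGED:
# `hessT (perF M_N A_N) V_N V′_N W_N = hessT (perF M_F A_F) V_F V′_F W_F + hessT (perF M_G A_G) V_G V′_G W_G` on the systems' ORIGINAL second-order tables

WHY.  `PackedLawFullIndexGraded` (this gen's INTENT-1) proved the one-system transfer parity-blind (`hessT_packedLeg_evenBlocks_eq_perF_letters`: the `kkt` slot fed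
with the blocks of the graded-even part `Ŵ♮`, the graded-odd part dead weight in `hessT` against a graded-even chart).  THIS FILE is the three-system socket in that
currency — the `hlaw` entry of (P2‴) `KernelPeriodisationFibHessKer.hessKer_law_of_torus_hessT_law` for the v4 wrapper, whose rows `hWNt ∕ hWFt ∕ hWGt` are gone
(Engine C R-FP-39-WNTWIN: the (III′) literal's `W2SymOfK` border is «MIXED» at depth 1, so those rows were uninhabitable as displayed) and whose `hHX₂ ∕ hQX₂` read
the even blocks.  [folklore] bookkeeping: three instances of INTENT-1's `_letters` lemma substituted into the packed law; no `def`, no `def … : Prop`, nothing cited,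
0 sorry; 0 estimates.  §2 DISCHARGES the coarse system's letter `hAσ_G` AT THE (III′) RECORD, BY NAME: the tree's lattice parity `CombChartWardSockets.trK_GcombSh`
(`trK G = sgnK G`: an2's «sgn-symmetric resolvent», `BorderedHessian.sgnF inl = 1 ∕ inr = −1`) + period invariance `CombHId2Record.translate_inv_GcombSh` (`Lc ∣ M i`)
through INTENT-1 §1b ⟹ **`perF_GcombSh_gradedEven`**; generic bridge `perF_gradedEven_of_trK_eq_sgnK` (any kernel with `trK K = sgnK K`).  NOT HERE: the v4 wrapper
itself, `hAσ_N ∕ hAσ_F` for the one-shot charts (the symmetric right inverse `X = D_σ·Â` of the wrapper's `hLN ∕ hLF`; successor), (P2‴).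

HONEST DEPENDENCY (page 1, mandatory): continuum YM on T⁴ ⇐ BetaPertH ∧ nine spine estimates (0/9 proved); BetaPertH ⇐ (D1) ∧ (D4) ∧ CAP+tail;
G-an2-4 gates asym, D1 and NE2/3/4.  HONEST FRAMING (cell contract, verbatim): «discharging `BetaPertH` makes Bałaban's UV stability UNCONDITIONAL —
a real constructive-QFT result; it is NOT the continuum limit and NOT the Clay problem.»  ABSOLUTE RULE (cell charter, verbatim): «No internally-minted
statement may enter as a cited fact. Every hypothesis is either kernel-proved in this package or a verbatim quotation of a PUBLISHED theorem with page
reference. The manuscript(s) under audit are NOT citable for their own disputed steps — they are the thing under adjudication; programme-internal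
(2001/route/tribunal) claims are never citable.»  Nothing of the dictionary's identification ∕ Bałaban's asserted; the parities and the packed law are
HYPOTHESES here; 0∕4 row-D1 binders (hW, hR, D1Tel, D1Rep); NOT (T-ID), NOT SDF, NOT D1, NOT BetaPertH, NOT continuum, NOT Clay.  Road «FP» OWNER,
b2b-balaban-beta-d1-p3 gen 40, 2026-08-27.  No existing file touched.
-/

noncomputable section

open scoped BigOperators Matrix

namespace Summit.QuantumFields.BalabanUV.Beta.FP.PackedLawFullIndexGradedSocket

open Matrix
open Literature.Probability.LatticeModels (Torus.proj)
open Literature.MathematicalPhysics.QuantumFieldTheory.Balaban1983to89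
open Literature.MathematicalPhysics.QuantumFieldTheory.Balaban1983to89.Beta
open Literature.MathematicalPhysics.QuantumFieldTheory.Balaban1983to89.Beta.Composition (kkt)
open B6Lemma24Torus (pbox)
open ExpKernelCalculus (MKer)
open AffineAveraging (Site)
open OneStepResolventKernel (Fib)
open Summit.QuantumFields.BalabanUV.Beta.AxialDressingRooted (axEc)
open Summit.QuantumFields.BalabanUV.Beta.D1BFx.MixedVarPackedHess (hessT)
open Summit.QuantumFields.BalabanUV.Beta.FP.KernelPeriodisationFib (Idx perF)
open B4TorusKernel.MultiPeriod (translate)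
open Summit.QuantumFields.BalabanUV.Beta.TameKernelCalculus (trK trK_apply)
open Summit.QuantumFields.BalabanUV.Beta.BorderedHessian (sgnK sgnK_apply sgnF sgnF_inl sgnF_inr)
open Summit.QuantumFields.BalabanUV.Beta.CombChartStepJets (GcombSh)
open Summit.QuantumFields.BalabanUV.Beta.CombChartWardSockets (trK_GcombSh)
open Summit.QuantumFields.BalabanUV.Beta.CombHId2Record (translate_inv_GcombSh)
open Summit.QuantumFields.BalabanUV.Beta.FP.PackedLawFullIndexGraded (perF_gradedEven_of_kernel hessT_packedLeg_evenBlocks_eq_perF_letters)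

/-! ## §1 The socket (S3-3) under R-FP-80: three systems, second-order slot parity-blind -/

section Socket

variable {d : ℕ}

/-- [folklore] **`hessT_fullIndex_law_of_packed_law_graded` — THE ASSEMBLY SOCKET (S3-3), PARITY-BLIND AT SECOND ORDER (R-FP-80).**  As #26
`hessT_fullIndex_law_of_packed_law` — three systems `X ∈ {N, F, G}`, each with its torus `M_X`, root `ρ_X`, comb modulus `L_X`, packing injection `f_X` (injective,
multiplier-valued, exactly over the root sites), chart kernel `A_X` under the torus rules `Ê·Â = Â = Â·Ê`, its LEG `L_X` DISPLAYED with the (S3-1) presentation, FULL-INDEX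
first jets `V_X V′_X` (`μμ`-free, SYMMETRIC twin) — but with the second-order table `W_X` only `μμ`-free (NO border parity), the chart parity **`hAσ_X : perF M_X A_X` is
graded-even** DISPLAYED instead, and the door's second-order BLOCKS bound to the EVEN blocks: `hH_X₂ : H_X₂ = Matrix.of (b b′ ↦ ½(Ŵ_X b̃ b̃′ + Ŵ_X b̃′ b̃))`,
`hQ_X₂ : Q_X₂ = Matrix.of (a b ↦ ½(Ŵ_X (f_X a) b̃ − Ŵ_X b̃ (f_X a)))`.  IF the packed law holds in the adapters' conclusion SHAPE THEN
`hessT (perF M_N A_N) V_N V′_N W_N = hessT (perF M_F A_F) V_F V′_F W_F + hessT (perF M_G A_G) V_G V′_G W_G` (`PackedLawFullIndexGraded.hessT_packedLeg_evenBlocks_eq_perF_letters` ×3). -/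
theorem hessT_fullIndex_law_of_packed_law_graded
    -- system N (one-shot): torus, packing injection, chart kernel under the torus rules; the LEG on the packed sorts with its (S3-1) presentation;
    -- full-index first jets with their parities, ANY μμ-free second-order table, the chart parity; the door's BLOCKS with their (S3-2) bindings (second order: the even blocks)
    {μN : Type*} [Fintype μN] (ρN : Fin (d + 1) → ℤ) (LNc : ℕ) (MN : Fin (d + 1) → ℕ) [∀ i, NeZero (MN i)] (fN : μN → Idx MN (Fib d))
    (hfN : Function.Injective fN) (hmN : ∀ a : μN, ∃ m : Fin (d + 1), (fN a).2 = Sum.inr m)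
    (hcN : ∀ (s : ↥(pbox MN)) (m : Fin (d + 1)), ((s, Sum.inr m) : Idx MN (Fib d)) ∈ Set.range fN ↔ Torus.proj LNc (s : Site (d + 1)) = 0)
    {AN : MKer (d + 1) (Fib d)} (hEAN : perF MN (axEc ρN LNc) * perF MN AN = perF MN AN)
    (hAEN : perF MN AN * perF MN (axEc ρN LNc) = perF MN AN)
    (LN : Matrix ((↥(pbox MN) × Fin (d + 1)) ⊕ μN) ((↥(pbox MN) × Fin (d + 1)) ⊕ μN) ℝ)
    (hLN : LN = fromBlocks
      (Matrix.of fun (b b' : ↥(pbox MN) × Fin (d + 1)) =>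
        axEc ρN LNc (b.1 : Site (d + 1)) (b.1 : Site (d + 1)) (Sum.inl b.2) (Sum.inl b.2)
          * (axEc ρN LNc (b'.1 : Site (d + 1)) (b'.1 : Site (d + 1)) (Sum.inl b'.2) (Sum.inl b'.2) * perF MN AN (b.1, Sum.inl b.2) (b'.1, Sum.inl b'.2)))
      (Matrix.of fun (b : ↥(pbox MN) × Fin (d + 1)) (a : μN) =>
        axEc ρN LNc (b.1 : Site (d + 1)) (b.1 : Site (d + 1)) (Sum.inl b.2) (Sum.inl b.2) * perF MN AN (b.1, Sum.inl b.2) (fN a))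
      (-Matrix.of fun (a : μN) (b : ↥(pbox MN) × Fin (d + 1)) =>
        axEc ρN LNc (b.1 : Site (d + 1)) (b.1 : Site (d + 1)) (Sum.inl b.2) (Sum.inl b.2) * perF MN AN (fN a) (b.1, Sum.inl b.2))
      (-((perF MN AN).submatrix fN fN)))
    (VN VN' WN : Matrix (Idx MN (Fib d)) (Idx MN (Fib d)) ℝ)
    (hVNm : ∀ a a' : μN, VN (fN a) (fN a') = 0)
    (hVNt : ∀ (b : ↥(pbox MN) × Fin (d + 1)) (a : μN), VN (b.1, Sum.inl b.2) (fN a) = VN (fN a) (b.1, Sum.inl b.2))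
    (hVN'm : ∀ a a' : μN, VN' (fN a) (fN a') = 0)
    (hVN't : ∀ (b : ↥(pbox MN) × Fin (d + 1)) (a : μN), VN' (b.1, Sum.inl b.2) (fN a) = VN' (fN a) (b.1, Sum.inl b.2))
    (hWNm : ∀ a a' : μN, WN (fN a) (fN a') = 0)
    (hAσN : ∀ p q : Idx MN (Fib d), perF MN AN p q
      = Sum.elim (fun _ : Fin (d + 1) => (1 : ℝ)) (fun _ : Fin (d + 1) => (-1 : ℝ)) p.2
        * Sum.elim (fun _ : Fin (d + 1) => (1 : ℝ)) (fun _ : Fin (d + 1) => (-1 : ℝ)) q.2 * perF MN AN q p)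
    (HN₁ HN₁' HN₂ : Matrix (↥(pbox MN) × Fin (d + 1)) (↥(pbox MN) × Fin (d + 1)) ℝ) (QN₁ QN₁' QN₂ : Matrix μN (↥(pbox MN) × Fin (d + 1)) ℝ)
    (hHN₁ : HN₁ = VN.submatrix (fun b : ↥(pbox MN) × Fin (d + 1) => ((b.1, Sum.inl b.2) : Idx MN (Fib d)))
      (fun b : ↥(pbox MN) × Fin (d + 1) => ((b.1, Sum.inl b.2) : Idx MN (Fib d))))
    (hQN₁ : QN₁ = VN.submatrix fN (fun b : ↥(pbox MN) × Fin (d + 1) => ((b.1, Sum.inl b.2) : Idx MN (Fib d))))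
    (hHN₁' : HN₁' = VN'.submatrix (fun b : ↥(pbox MN) × Fin (d + 1) => ((b.1, Sum.inl b.2) : Idx MN (Fib d)))
      (fun b : ↥(pbox MN) × Fin (d + 1) => ((b.1, Sum.inl b.2) : Idx MN (Fib d))))
    (hQN₁' : QN₁' = VN'.submatrix fN (fun b : ↥(pbox MN) × Fin (d + 1) => ((b.1, Sum.inl b.2) : Idx MN (Fib d))))
    (hHN₂ : HN₂ = Matrix.of fun b b' : ↥(pbox MN) × Fin (d + 1) =>
      (1 / 2 : ℝ) * (WN (b.1, Sum.inl b.2) (b'.1, Sum.inl b'.2) + WN (b'.1, Sum.inl b'.2) (b.1, Sum.inl b.2)))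
    (hQN₂ : QN₂ = Matrix.of fun (a : μN) (b : ↥(pbox MN) × Fin (d + 1)) =>
      (1 / 2 : ℝ) * (WN (fN a) (b.1, Sum.inl b.2) - WN (b.1, Sum.inl b.2) (fN a)))
    -- system F (fine): torus, packing injection, chart kernel under the torus rules; the LEG on the packed sorts with its (S3-1) presentation;
    -- full-index first jets with their parities, ANY μμ-free second-order table, the chart parity; the door's BLOCKS with their (S3-2) bindings (second order: the even blocks)
    {μF : Type*} [Fintype μF] (ρF : Fin (d + 1) → ℤ) (LFc : ℕ) (MF : Fin (d + 1) → ℕ) [∀ i, NeZero (MF i)] (fF : μF → Idx MF (Fib d))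
    (hfF : Function.Injective fF) (hmF : ∀ a : μF, ∃ m : Fin (d + 1), (fF a).2 = Sum.inr m)
    (hcF : ∀ (s : ↥(pbox MF)) (m : Fin (d + 1)), ((s, Sum.inr m) : Idx MF (Fib d)) ∈ Set.range fF ↔ Torus.proj LFc (s : Site (d + 1)) = 0)
    {AF : MKer (d + 1) (Fib d)} (hEAF : perF MF (axEc ρF LFc) * perF MF AF = perF MF AF)
    (hAEF : perF MF AF * perF MF (axEc ρF LFc) = perF MF AF)
    (LF : Matrix ((↥(pbox MF) × Fin (d + 1)) ⊕ μF) ((↥(pbox MF) × Fin (d + 1)) ⊕ μF) ℝ)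
    (hLF : LF = fromBlocks
      (Matrix.of fun (b b' : ↥(pbox MF) × Fin (d + 1)) =>
        axEc ρF LFc (b.1 : Site (d + 1)) (b.1 : Site (d + 1)) (Sum.inl b.2) (Sum.inl b.2)
          * (axEc ρF LFc (b'.1 : Site (d + 1)) (b'.1 : Site (d + 1)) (Sum.inl b'.2) (Sum.inl b'.2) * perF MF AF (b.1, Sum.inl b.2) (b'.1, Sum.inl b'.2)))
      (Matrix.of fun (b : ↥(pbox MF) × Fin (d + 1)) (a : μF) =>
        axEc ρF LFc (b.1 : Site (d + 1)) (b.1 : Site (d + 1)) (Sum.inl b.2) (Sum.inl b.2) * perF MF AF (b.1, Sum.inl b.2) (fF a))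
      (-Matrix.of fun (a : μF) (b : ↥(pbox MF) × Fin (d + 1)) =>
        axEc ρF LFc (b.1 : Site (d + 1)) (b.1 : Site (d + 1)) (Sum.inl b.2) (Sum.inl b.2) * perF MF AF (fF a) (b.1, Sum.inl b.2))
      (-((perF MF AF).submatrix fF fF)))
    (VF VF' WF : Matrix (Idx MF (Fib d)) (Idx MF (Fib d)) ℝ)
    (hVFm : ∀ a a' : μF, VF (fF a) (fF a') = 0)
    (hVFt : ∀ (b : ↥(pbox MF) × Fin (d + 1)) (a : μF), VF (b.1, Sum.inl b.2) (fF a) = VF (fF a) (b.1, Sum.inl b.2))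
    (hVF'm : ∀ a a' : μF, VF' (fF a) (fF a') = 0)
    (hVF't : ∀ (b : ↥(pbox MF) × Fin (d + 1)) (a : μF), VF' (b.1, Sum.inl b.2) (fF a) = VF' (fF a) (b.1, Sum.inl b.2))
    (hWFm : ∀ a a' : μF, WF (fF a) (fF a') = 0)
    (hAσF : ∀ p q : Idx MF (Fib d), perF MF AF p q
      = Sum.elim (fun _ : Fin (d + 1) => (1 : ℝ)) (fun _ : Fin (d + 1) => (-1 : ℝ)) p.2
        * Sum.elim (fun _ : Fin (d + 1) => (1 : ℝ)) (fun _ : Fin (d + 1) => (-1 : ℝ)) q.2 * perF MF AF q p)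
    (HF₁ HF₁' HF₂ : Matrix (↥(pbox MF) × Fin (d + 1)) (↥(pbox MF) × Fin (d + 1)) ℝ) (QF₁ QF₁' QF₂ : Matrix μF (↥(pbox MF) × Fin (d + 1)) ℝ)
    (hHF₁ : HF₁ = VF.submatrix (fun b : ↥(pbox MF) × Fin (d + 1) => ((b.1, Sum.inl b.2) : Idx MF (Fib d)))
      (fun b : ↥(pbox MF) × Fin (d + 1) => ((b.1, Sum.inl b.2) : Idx MF (Fib d))))
    (hQF₁ : QF₁ = VF.submatrix fF (fun b : ↥(pbox MF) × Fin (d + 1) => ((b.1, Sum.inl b.2) : Idx MF (Fib d))))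
    (hHF₁' : HF₁' = VF'.submatrix (fun b : ↥(pbox MF) × Fin (d + 1) => ((b.1, Sum.inl b.2) : Idx MF (Fib d)))
      (fun b : ↥(pbox MF) × Fin (d + 1) => ((b.1, Sum.inl b.2) : Idx MF (Fib d))))
    (hQF₁' : QF₁' = VF'.submatrix fF (fun b : ↥(pbox MF) × Fin (d + 1) => ((b.1, Sum.inl b.2) : Idx MF (Fib d))))
    (hHF₂ : HF₂ = Matrix.of fun b b' : ↥(pbox MF) × Fin (d + 1) =>
      (1 / 2 : ℝ) * (WF (b.1, Sum.inl b.2) (b'.1, Sum.inl b'.2) + WF (b'.1, Sum.inl b'.2) (b.1, Sum.inl b.2)))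
    (hQF₂ : QF₂ = Matrix.of fun (a : μF) (b : ↥(pbox MF) × Fin (d + 1)) =>
      (1 / 2 : ℝ) * (WF (fF a) (b.1, Sum.inl b.2) - WF (b.1, Sum.inl b.2) (fF a)))
    -- system G (coarse): torus, packing injection, chart kernel under the torus rules; the LEG on the packed sorts with its (S3-1) presentation;
    -- full-index first jets with their parities, ANY μμ-free second-order table, the chart parity; the door's BLOCKS with their (S3-2) bindings (second order: the even blocks)
    {μG : Type*} [Fintype μG] (ρG : Fin (d + 1) → ℤ) (LGc : ℕ) (MG : Fin (d + 1) → ℕ) [∀ i, NeZero (MG i)] (fG : μG → Idx MG (Fib d))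
    (hfG : Function.Injective fG) (hmG : ∀ a : μG, ∃ m : Fin (d + 1), (fG a).2 = Sum.inr m)
    (hcG : ∀ (s : ↥(pbox MG)) (m : Fin (d + 1)), ((s, Sum.inr m) : Idx MG (Fib d)) ∈ Set.range fG ↔ Torus.proj LGc (s : Site (d + 1)) = 0)
    {AG : MKer (d + 1) (Fib d)} (hEAG : perF MG (axEc ρG LGc) * perF MG AG = perF MG AG)
    (hAEG : perF MG AG * perF MG (axEc ρG LGc) = perF MG AG)
    (LG : Matrix ((↥(pbox MG) × Fin (d + 1)) ⊕ μG) ((↥(pbox MG) × Fin (d + 1)) ⊕ μG) ℝ)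
    (hLG : LG = fromBlocks
      (Matrix.of fun (b b' : ↥(pbox MG) × Fin (d + 1)) =>
        axEc ρG LGc (b.1 : Site (d + 1)) (b.1 : Site (d + 1)) (Sum.inl b.2) (Sum.inl b.2)
          * (axEc ρG LGc (b'.1 : Site (d + 1)) (b'.1 : Site (d + 1)) (Sum.inl b'.2) (Sum.inl b'.2) * perF MG AG (b.1, Sum.inl b.2) (b'.1, Sum.inl b'.2)))
      (Matrix.of fun (b : ↥(pbox MG) × Fin (d + 1)) (a : μG) =>
        axEc ρG LGc (b.1 : Site (d + 1)) (b.1 : Site (d + 1)) (Sum.inl b.2) (Sum.inl b.2) * perF MG AG (b.1, Sum.inl b.2) (fG a))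
      (-Matrix.of fun (a : μG) (b : ↥(pbox MG) × Fin (d + 1)) =>
        axEc ρG LGc (b.1 : Site (d + 1)) (b.1 : Site (d + 1)) (Sum.inl b.2) (Sum.inl b.2) * perF MG AG (fG a) (b.1, Sum.inl b.2))
      (-((perF MG AG).submatrix fG fG)))
    (VG VG' WG : Matrix (Idx MG (Fib d)) (Idx MG (Fib d)) ℝ)
    (hVGm : ∀ a a' : μG, VG (fG a) (fG a') = 0)
    (hVGt : ∀ (b : ↥(pbox MG) × Fin (d + 1)) (a : μG), VG (b.1, Sum.inl b.2) (fG a) = VG (fG a) (b.1, Sum.inl b.2))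
    (hVG'm : ∀ a a' : μG, VG' (fG a) (fG a') = 0)
    (hVG't : ∀ (b : ↥(pbox MG) × Fin (d + 1)) (a : μG), VG' (b.1, Sum.inl b.2) (fG a) = VG' (fG a) (b.1, Sum.inl b.2))
    (hWGm : ∀ a a' : μG, WG (fG a) (fG a') = 0)
    (hAσG : ∀ p q : Idx MG (Fib d), perF MG AG p q
      = Sum.elim (fun _ : Fin (d + 1) => (1 : ℝ)) (fun _ : Fin (d + 1) => (-1 : ℝ)) p.2
        * Sum.elim (fun _ : Fin (d + 1) => (1 : ℝ)) (fun _ : Fin (d + 1) => (-1 : ℝ)) q.2 * perF MG AG q p)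
    (HG₁ HG₁' HG₂ : Matrix (↥(pbox MG) × Fin (d + 1)) (↥(pbox MG) × Fin (d + 1)) ℝ) (QG₁ QG₁' QG₂ : Matrix μG (↥(pbox MG) × Fin (d + 1)) ℝ)
    (hHG₁ : HG₁ = VG.submatrix (fun b : ↥(pbox MG) × Fin (d + 1) => ((b.1, Sum.inl b.2) : Idx MG (Fib d)))
      (fun b : ↥(pbox MG) × Fin (d + 1) => ((b.1, Sum.inl b.2) : Idx MG (Fib d))))
    (hQG₁ : QG₁ = VG.submatrix fG (fun b : ↥(pbox MG) × Fin (d + 1) => ((b.1, Sum.inl b.2) : Idx MG (Fib d))))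
    (hHG₁' : HG₁' = VG'.submatrix (fun b : ↥(pbox MG) × Fin (d + 1) => ((b.1, Sum.inl b.2) : Idx MG (Fib d)))
      (fun b : ↥(pbox MG) × Fin (d + 1) => ((b.1, Sum.inl b.2) : Idx MG (Fib d))))
    (hQG₁' : QG₁' = VG'.submatrix fG (fun b : ↥(pbox MG) × Fin (d + 1) => ((b.1, Sum.inl b.2) : Idx MG (Fib d))))
    (hHG₂ : HG₂ = Matrix.of fun b b' : ↥(pbox MG) × Fin (d + 1) =>
      (1 / 2 : ℝ) * (WG (b.1, Sum.inl b.2) (b'.1, Sum.inl b'.2) + WG (b'.1, Sum.inl b'.2) (b.1, Sum.inl b.2)))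
    (hQG₂ : QG₂ = Matrix.of fun (a : μG) (b : ↥(pbox MG) × Fin (d + 1)) =>
      (1 / 2 : ℝ) * (WG (fG a) (b.1, Sum.inl b.2) - WG (b.1, Sum.inl b.2) (fG a)))
    -- THE PACKED LAW, in the adapters' conclusion shape
    (hlaw : hessT LN (fromBlocks HN₁ (-QN₁ᵀ) QN₁ 0) (fromBlocks HN₁' (-QN₁'ᵀ) QN₁' 0) (kkt HN₂ QN₂)
      = hessT LF (fromBlocks HF₁ (-QF₁ᵀ) QF₁ 0) (fromBlocks HF₁' (-QF₁'ᵀ) QF₁' 0) (kkt HF₂ QF₂)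
        + hessT LG (fromBlocks HG₁ (-QG₁ᵀ) QG₁ 0) (fromBlocks HG₁' (-QG₁'ᵀ) QG₁' 0) (kkt HG₂ QG₂)) :
    hessT (perF MN AN) VN VN' WN = hessT (perF MF AF) VF VF' WF + hessT (perF MG AG) VG VG' WG := by
  rw [hessT_packedLeg_evenBlocks_eq_perF_letters ρN MN fN hfN hmN hcN hEAN hAEN hAσN VN VN' WN hVNm hVNt hVN'm hVN't hWNm LN hLN HN₁ HN₁' HN₂ QN₁ QN₁' QN₂
      hHN₁ hQN₁ hHN₁' hQN₁' hHN₂ hQN₂,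
    hessT_packedLeg_evenBlocks_eq_perF_letters ρF MF fF hfF hmF hcF hEAF hAEF hAσF VF VF' WF hVFm hVFt hVF'm hVF't hWFm LF hLF HF₁ HF₁' HF₂ QF₁ QF₁' QF₂
      hHF₁ hQF₁ hHF₁' hQF₁' hHF₂ hQF₂,
    hessT_packedLeg_evenBlocks_eq_perF_letters ρG MG fG hfG hmG hcG hEAG hAEG hAσG VG VG' WG hVGm hVGt hVG'm hVG't hWGm LG hLG HG₁ HG₁' HG₂ QG₁ QG₁' QG₂
      hHG₁ hQG₁ hHG₁' hQG₁' hHG₂ hQG₂] at hlaw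
  exact hlaw

end Socket

/-! ## §2 The chart-parity letter AT THE (III′) RECORD for the coarse system: `perF M (GcombSh Lc j)` is graded-even -/

section RecordG

variable {d : ℕ} (M : Fin (d + 1) → ℕ)

/-- [folklore] **`perF_gradedEven_of_trK_eq_sgnK`** — INTENT-1 §1b in the tree's vocabulary: a kernel with `trK K = sgnK K` (an2's «sgn-symmetric»: `K y x b a =
sgnF a · sgnF b · K x y a b`) that is `M`-invariant periodises to a GRADED-EVEN torus matrix (`sgnF = Sum.elim 1 (−1)` on constructors). -/
theorem perF_gradedEven_of_trK_eq_sgnK {K : MKer (d + 1) (Fib d)} (h : trK K = sgnK K)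
    (hK : ∀ (m x y : Fin (d + 1) → ℤ) (a b : Fib d), K (translate M x m) (translate M y m) a b = K x y a b) (p q : Idx M (Fib d)) :
    perF M K p q
      = Sum.elim (fun _ : Fin (d + 1) => (1 : ℝ)) (fun _ : Fin (d + 1) => (-1 : ℝ)) p.2
        * Sum.elim (fun _ : Fin (d + 1) => (1 : ℝ)) (fun _ : Fin (d + 1) => (-1 : ℝ)) q.2 * perF M K q p := by
  refine perF_gradedEven_of_kernel M (fun x y a b => ?_) hK p q
  have h1 := congrFun (congrFun (congrFun (congrFun h y) x) b) a
  rw [trK_apply, sgnK_apply] at h1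
  rw [h1]
  rcases a with α | m <;> rcases b with β | m' <;> simp only [sgnF_inl, sgnF_inr, Sum.elim_inl, Sum.elim_inr] <;> ring

variable {Lc : ℕ} [NeZero Lc]

/-- [folklore] **`perF_GcombSh_gradedEven` — THE LETTER `hAσ_G` OF R-FP-80 DISCHARGED AT THE (III′) RECORD, BY NAME**: on every box with `Lc ∣ M i`, the periodised
comb-chart resolvent is graded-even — `Â((x̄,a),(z̄,b)) = s a · s b · Â((z̄,b),(x̄,a))`, `Â := perF M (GcombSh Lc j)` (ff ∕ μμ symmetric, border anti-twin: an2 g45's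
(L0) `CombHId2TorusTwin.perF_GcombSh_border_antitwin` is the border face) — `CombChartWardSockets.trK_GcombSh` + `CombHId2Record.translate_inv_GcombSh`. -/
theorem perF_GcombSh_gradedEven (hLM : ∀ i, Lc ∣ M i) (j : ℕ) (p q : Idx M (Fib d)) :
    perF M (GcombSh (d := d) Lc j) p q
      = Sum.elim (fun _ : Fin (d + 1) => (1 : ℝ)) (fun _ : Fin (d + 1) => (-1 : ℝ)) p.2
        * Sum.elim (fun _ : Fin (d + 1) => (1 : ℝ)) (fun _ : Fin (d + 1) => (-1 : ℝ)) q.2 * perF M (GcombSh (d := d) Lc j) q p :=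
  perF_gradedEven_of_trK_eq_sgnK M (trK_GcombSh (d := d) (Lc := Lc) j) (translate_inv_GcombSh M hLM j) p q

end RecordG

end Summit.QuantumFields.BalabanUV.Beta.FP.PackedLawFullIndexGradedSocket

end
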